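/-
Copyright: statement-level skeleton of a published paper (lit-balaban cell, Phase-2 proof seat p27, gen 31; v1.1 gen 33). No proof claims
beyond what the kernel checks below.
-/
import Mathlib
import Literature.MathematicalPhysics.QuantumFieldTheory.BalabanImbrieJaffe1984to88.BIJ85Tau1ClosedCube
import Literature.MathematicalPhysics.QuantumFieldTheory.BalabanImbrieJaffe1984to88.BIJ85Eq7113ClosedCubeMinimiser

/-!
# `BalabanImbrieJaffe1984to88.BIJ85Eq7113AxisFibres` — T. Bałaban, J. Imbrie, A. Jaffe, *Renormalization of the Higgs model:
minimizers, propagators and the stability of mean field theory*, Commun. Math. Phys. **97** (1985) 299–329 [BalabanImbrieJaffe1985]: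
Sect. 7.1 pp. 322–324, (7.1.12)–(7.1.16) — **`σ_k(p′) = τ₁(p′) + τ₂(p′)` FOR THE σ_k OF RECORD AT EVERY DUAL MOMENTUM, THE AXIS FIBRES
`p′_μ = 0` AND `p′ = 0` INCLUDED, IN THE REGULARIZED READING**: the constrained fibre minimum `m_{p′}(f) = min{‖∂A − Q^{e*}_kf‖² : Q_kA = 0}`
of the (4.2.1) exponent with seat p10's division-free closed-cube weights is attained and equals `Re⟨f, σ^C_k(p′)f⟩`, p10's
`BIJ85SigmaClosedCube.sigmaC = tau1C + tau2C` ((7.1.13)–(7.1.16) with the removable singularities of (7.1.7)/(7.1.10) filled, the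
bracket `[δ − ∂∂̄/Δ] = δ` at `∂ = 0`, `τ₂^C(0) = 0`), at EVERY `p′` of the closed cube `|p′_j| ≤ π` — for `p′ ≠ 0` by file 2's transported
minimiser (upper bound) and p10's Part-5 projection limit (lower bound), for `p′ = 0` directly (the constraint reads `A(0) = 0`, the
Hodge field of file 1 satisfies it); hence `fibreMin (2M+1) N q φ = 2·Re⟨φ, σ^C(q)φ⟩` for EVERY `q : Tor N` and, for the σ_k and τ₂ OF
RECORD (p30/p33's `sigmaTorus`, `tau2Torus`; symbols = p33's `symb sigmaMatrix`/`symb tau2Matrix`), `⟨ψ, σ_k(p′)ψ⟩ = Re⟨ψ^asym, σ^C(p′)ψ^asym⟩`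
and `⟨ψ, τ₂(p′)ψ⟩ = Re⟨ψ^asym, τ₂^C(p′)ψ^asym⟩` at EVERY dual momentum `p′` of `T₁^{(k)}` — gen 6's `symb_sigmaMatrix_form_eq_sigmaSym`
(p262004) and `symb_tau2Matrix_form_eq_tau2Sym` (p264605), which needed all `p′_μ ≠ 0`, extended to the axes (file 3 of 3; file 1
`BIJ85Tau1ClosedCube` = τ₁, file 2 `BIJ85Eq7113ClosedCubeMinimiser` = the transported minimiser)

statement-level skeleton of published theorems with citation tags; proofs where landed; nothing here is a claim about
the Yang–Mills mass gap

PDF held: `paper:balaban1985-cmp97-bij-higgs-minimizers` (journal page = PDF page + 298); pp. 322–324 [PDF 24–26] re-read as images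
(`run/shared/lean/pub/pub-balaban/t4/b2b-balaban-t4-lit2/renders/bij1985/1985-cmp97-bij-higgs-minimizers-p024-x2.png` …).

THE PRINTED TEXT (verbatim, pp. 322–324; v1.1 — the quotation block of v1.0 (p337783) corrected at the four loci of referee ref-1's
gen-70 fidelity note against the renders `…-p024-x2.png`/`…-p025-x2.png`/`…-p026-x2.png`: the (7.1.15) prefactor, the two connecting
phrases around (7.1.15)/(7.1.16), an unprinted sentence formerly inside the marks, and the p. 324 positivity sentence; declarations
untouched).  p. 322: *"We express σ_k as a sum of two terms σ_k = τ₁ + τ₂. (7.1.13) Here τ₁ vanishes on curls. Thus if f = ∂B, then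
τ₁f = 0. Explicitly"* [(7.1.14), quoted in file 1 `BIJ85Tau1ClosedCube`]; p. 323: *"and
τ_{2,μνλκ}(p′) = (a_μā_λ(φ_νφ_κ)^{−1/2}[δ_{νκ} − (∂^{(1)}_ν\overline{∂^{(1)}_κ}/√(φ_νφ_κ))(Σ_ρ|∂^{(1)}_ρ|²/φ_ρ)^{−1}])(p′). (7.1.15) In the formula for
τ₁(p′), each term on the right side is evaluated at momentum p′ + l. In the formula for τ₂, the averaging only occurs in
a_μ(p′) = ∂^{(1)}_μ(p′)Σ_l(|u/v_μ|²(1/Δ))(p′+l). (7.1.16) In both τ₁ and τ₂ the expressions inside brackets [ ] are projection operators.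
Thus σ_k has the general form of a sum of projection operators, or tensor products of projection operators, sandwiched between
averaging operators."*; p. 324: *"It is sufficient to show that there is a constant c > 0 such that c ≤ σ_k(p) (7.1.22) for all
|p_j| ≤ π."*; *"The idea is to bound ⟨f, τ₂f⟩ using the positivity of τ₂. In fact, 0 ≤ τ₂ is evident from (7.1.15)."*
READING (ours, not printed).  By (7.1.16) `a_μ(p′)` carries the factor `∂^{(1)}_μ(p′)`, so `a(0) = 0`.  On the axis fibres the printed
`v_μ`, `φ_μ`, `a_μ` are `0/0` (GAPS G-C1-03); in the regularized reading (p10) `v_μ` is continued by 1, and at `p′ = 0` (where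
`∂^{(1)}(0) = 0`) `a(0) = 0`, `τ₂(0) = 0`.

CITATION HEADER (lean-in-tree rule).  Part of the lit-balaban TYPED SKELETON (HOME `run/shared/lean/pub/lit-balaban/`), Phase-2 seat p27
(gen 31), unit `lit-balaban-p27`; rows **C1.Eq7.1.13-7.1.19**, **C1.Eq7.1.2-7.1.12** (fold owner r15, referee ref-5); r15's `C1-CLOSURE.md`
§5 item 1 *"(7.1.x) on the axis fibres … a regularized statement of (7.1.14)–(7.1.16) at p′_μ = 0 matching the closed-cube forms"*.
INPUTS (all landed or filed by this seat, consumed by name): file 1 (`isLeast_energyC_free`, `energyC_hodge_eq`, `tau1C_form_le_energyC`,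
`fibreMinU_eq_two_mul_tau1C_form`), file 2 (`exists_constrained_energyC_eq_form`, `le_of_fillPath`, `fillPath_generic`, `fillPath_ne_zero`,
`bZeroC`), p10's `BIJ85Eq7113DerivationPart3` (`energy_ge`, `generic_scale`), `…Part5` (`proj`, `qOpC_proj`, `proj_of_constrained`,
`dDiag_pos`, `continuousOn_energyC_proj`, `qOpC_eq_qOp`, `energyC_eq_energy`), `…Part6` (`fibreConstraint_iff`, `fibreEnergy_eq`),
`BIJ85SigmaClosedCube` (`sigmaC`, `sigmaC_form_eq`, `dSym_shift_eq_zero_iff`, `vC_eq_one`, `vC_eq_vSym`), `BIJ85SigmaClosedCubeZero`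
(`tau2C_zero`), `BIJ85Thm711ClosedCube` (`continuousOn_form`, `mem_regSet`); this seat's gen 6 `BIJ85Eq7112SymbolFibreMin`
(`symb_sigmaMatrix_form_eq_half_fibreMin`), `BIJ85Eq7114Tau1Identification` (`symb_tau2Matrix_form_eq_half_sub`), `BIJ85Eq7113SymbolIdentification`
(`energyC_comp_res`, `qOpC_comp_res`, `fibreMin_congr_n`).
WHAT IS KERNEL-CHECKED (zero `sorry`, standard axioms; THEOREMS ONLY — no `def`, no new named fact, D-0026):
§1 **`sigmaC_form_le_energyC`**: `Re⟨f, σ^C_k(p′)f⟩ ≤ ‖∂A − Q^{e*}_kf‖²_C` for every CONSTRAINED `A` at every `p′ ≠ 0` of the closed cube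
(p10's generic `energy_ge` on the projections `proj (fillPath p′ t) A`, `t → 0⁺`);
§2 the fibre `p′ = 0`: `vC`/`uC`/`rC` at the shifts `2πm` (`rC_zero_shift`: `r_ν(2πm) = δ_{m,0}`), the constraint reads `A(0) = 0`
(`qOpC_zero_iff`), `σ^C(0) = τ₁^C(0)` as forms (`sigmaC_form_zero`), and the Hodge field `B₀^C` of file 1 is constrained at `0`;
§3 **`isLeast_energyC_constrained`**: at EVERY `p′` of the closed cube (any `Scale`, `0 < d`, two-forms `f`)
`min{‖∂A − Q^{e*}_kf‖²_C : Q_kA = 0} = Re⟨f, (τ₁^C + τ₂^C)(p′)f⟩`; §4 **`fibreMin_eq_two_mul_sigmaC_form`** (`∀ q : Tor N`, `n = 2M + 1`),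
`fibreMin_sub_fibreMinU_eq_two_mul_tau2C_form`, `tau2C_form_nonneg` (p. 324 *"0 ≤ τ₂"* for the regularized symbol at EVERY `q`);
§5 for the σ_k / τ₂ OF RECORD (`k ≤ m + K`, `2 ≤ d`, any curl factor `c ≠ 0`, `L^k = 2M + 1`), at EVERY dual momentum `p′`:
**`symb_sigmaMatrix_form_eq_sigmaC`**, **`symb_tau2Matrix_form_eq_tau2C`**, and at `p′ = 0`: `symb_tau2Matrix_form_zero` (`⟨ψ, τ₂(0)ψ⟩ = 0`).
HONEST SCOPE: this is the identification in p10's REGULARIZED reading of (7.1.13)–(7.1.16) (the printed quotients continued through their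
removable singularities; equal to r15's printed `sigmaSym`/`tau2Sym` off the axes by p10's `sigmaC_form_eq`/`tau2C_eq_tau2Sym`, so the
gen-6 theorems are the generic case of these); whether the repaired reading counts for the row heads is the owner's/referee's call
(G8-1/§C.6).  Odd block sizes only (`Params.hL`: `L` odd; GAPS G-C1-p27-02 on even `L` concerns the configuration-space Theorem 7.1.1
and is RESOLVED by p10's `BIJ85Thm711AllL`).
-/

namespace Literature.MathematicalPhysics.QuantumFieldTheory.BalabanImbrieJaffe1984to88.BIJ85Eq7113AxisFibres

open scoped BigOperators Matrix ComplexConjugate Topology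
open Filter
open Literature.MathematicalPhysics.QuantumFieldTheory.Balaban1983to89
open B5Prop11Plancherel (Tor fine sOf abs_sOf_le sOf_zero)
open B5Eq117TorusCarriers (Mk)
open BIJ85MomentumSymbols71 (tensorInner dSym dOne lapSym lShifts shiftMom vSym_eq dOne_shiftMom zero_mem_lShifts shiftMom_zero)
open BIJ85CurlComplement719 (IsTwoForm)
open BIJ85Prop712Fibre (tensorInner_add_kernel)
open BIJ85Thm711Fibrewise (Scale sigmaSym)
open BIJ85SigmaClosedCube (vC uC tau1C tau2C sigmaC regSet fillPath sigmaC_form_eq dSym_shift_eq_zero_iff vC_eq_one vC_eq_vSym)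
open BIJ85SigmaClosedCubeZero (tau2C_zero)
open BIJ85Thm711ClosedCube (continuousOn_form mem_regSet)
open BIJ85Eq7113Derivation (Generic energy qOp pNormSq curlF coD)
open BIJ85Eq7113DerivationPart3 (energy_ge generic_scale)
open BIJ85Eq7113DerivationPart5 (rC qeStarC qOpC energyC proj regC qOpC_proj proj_of_constrained dDiag_pos
  continuousOn_energyC_proj qOpC_eq_qOp energyC_eq_energy)
open BIJ85Eq7113DerivationPart6 (resE resR fibreConstraint_iff fibreEnergy_eq)
open BIJ85Eq7112FibreEnergy (fibreEnergy FibreConstraint)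
open BIJ85Eq712Plancherel (symb)
open BIJ85Sigma712Torus (Orient torN sigmaMatrix)
open BIJ85Eq7112SymbolFibreMin (asymO symb_sigmaMatrix_form_eq_half_fibreMin)
open BIJ85Eq7113SymbolIdentification (energyC_comp_res qOpC_comp_res asymO_swap fibreMin_congr_n)
open BIJ85Eq7117FibreMinFree (fibreMinU fibreMinU_le_fibreMin)
open BIJ85Eq7117Tau1Symbol (tau2Matrix)
open BIJ85Eq7114Tau1Identification (fibreMinU_congr_n symb_tau2Matrix_form_eq_half_sub)
open BIJ85Tau1ClosedCube (isLeast_energyC_free energyC_hodge_eq tau1C_form_le_energyC fibreMinU_eq_two_mul_tau1C_form)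
open BIJ85Eq7113ClosedCubeMinimiser (bZeroC exists_constrained_energyC_eq_form le_of_fillPath fillPath_generic fillPath_ne_zero)
open BIJ85Sigma421Torus BIJ85Eq7112FibreMin

noncomputable section

variable {d : ℕ}

/-! ## §1 No constrained field beats the regularized form, at every `p′ ≠ 0` of the closed cube -/

section Lower

variable {p : Fin d → ℝ}

/-- At a generic fibre: `Re⟨f, σ^C_k(p′)f⟩ ≤ ‖∂A − Q^{e*}_kf‖²_C` for every constrained `A` — p10's `energy_ge` read in the closed-cube
data (`energyC_eq_energy`, `qOpC_eq_qOp`, `sigmaC_form_eq`). [cite: BalabanImbrieJaffe1985, (7.1.13) p.322] -/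
theorem sigmaC_form_le_energyC_generic (hd : 0 < d) (s : Scale) (hp : ∀ i, p i ≠ 0 ∧ |p i| ≤ Real.pi) {f : Fin d → Fin d → ℂ}
    (hf : IsTwoForm f) {A : (Fin d → ℤ) → Fin d → ℂ} (hA : ∀ ν, qOpC s.n s.M p A ν = 0) :
    (tensorInner f (sigmaC s.n s.M p) f).re ≤ energyC s.n s.M p A f := by
  have hn : 0 < s.n := s.pos.1
  have hG : Generic ((s.n : ℝ)⁻¹) s.M p := generic_scale hd s hp
  have hA' : ∀ ν, qOp ((s.n : ℝ)⁻¹) s.M p A ν = 0 := fun ν => by rw [← qOpC_eq_qOp hn hp]; exact hA ν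
  rw [sigmaC_form_eq hn s.M hp hf, energyC_eq_energy hn hp A hf]
  exact energy_ge hG hf hA'

/-- **`Re⟨f, σ^C_k(p′)f⟩ ≤ ‖∂A − Q^{e*}_kf‖²_C` for every constrained `A` at EVERY `p′ ≠ 0` of the closed cube** (axis fibres included):
project `A` onto the constraint spaces of the generic momenta `fillPath p′ t` (p10's `proj`), apply the generic bound, and let
`t → 0⁺` — the projected energy is continuous (`continuousOn_energyC_proj`), the form is continuous (`continuousOn_form`), and the
projection is `A` itself at `t = 0`. [cite: BalabanImbrieJaffe1985, (7.1.13) p.322] -/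
theorem sigmaC_form_le_energyC (hd : 0 < d) (s : Scale) (hp : ∀ i, |p i| ≤ Real.pi) (hp0 : p ≠ 0) {f : Fin d → Fin d → ℂ}
    (hf : IsTwoForm f) {A : (Fin d → ℤ) → Fin d → ℂ} (hA : ∀ ν, qOpC s.n s.M p A ν = 0) :
    (tensorInner f (sigmaC s.n s.M p) f).re ≤ energyC s.n s.M p A f := by
  have hn : 0 < s.n := s.pos.1
  have hregC : ∀ q : Fin d → ℝ, (∀ i, |q i| ≤ Real.pi) → q ∈ regC (d := d) s.n s.M := fun q hq ν =>
    (dDiag_pos hn s.M hq ν).ne'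
  have hS : ∀ t ∈ Set.Ioc (0 : ℝ) Real.pi, fillPath p t ∈ regSet (d := d) s.n s.M := fun t ht =>
    mem_regSet hn s.M (fun i => (fillPath_generic hp ht.1 ht.2 i).2) (fillPath_ne_zero hp0 t)
  have hT : ∀ t ∈ Set.Ioc (0 : ℝ) Real.pi, fillPath p t ∈ regC (d := d) s.n s.M := fun t ht =>
    hregC _ fun i => (fillPath_generic hp ht.1 ht.2 i).2
  have h := le_of_fillPath (G := fun q => energyC s.n s.M q (proj s.n s.M q A) f)
    ((continuousOn_form s.n s.M f) p (mem_regSet hn s.M hp hp0)) ((continuousOn_energyC_proj s.n s.M A f) p (hregC p hp))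
    hS hT fun t ht => ?_
  · simpa only [proj_of_constrained hA] using h
  · have hgen := fillPath_generic hp ht.1 ht.2
    have hD : ∀ ν, BIJ85Eq7113DerivationPart5.dDiag s.n s.M (fillPath p t) ν ≠ 0 := fun ν =>
      (dDiag_pos hn s.M (fun i => (hgen i).2) ν).ne'
    exact sigmaC_form_le_energyC_generic hd s hgen hf (qOpC_proj hD A)

end Lower

/-! ## §2 The fibre `p′ = 0`: the constraint reads `A(0) = 0`, and `σ^C(0) = τ₁^C(0)` -/

section Zero

variable {n M : ℕ}

/-- kernel: `|0| ≤ π` componentwise. [folklore] -/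
private theorem abs_zero_le_pi (μ : Fin d) : |(0 : Fin d → ℝ) μ| ≤ Real.pi := by
  rw [Pi.zero_apply, abs_zero]; exact Real.pi_pos.le

/-- At `p′ = 0` the regularized block-average symbol at the shift `2πm` is `v^C_ρ(2πm) = δ_{m_ρ,0}` (`|m_i| ≤ M`, `2M + 1 ≤ n`): 1 where
`∂_ρ(2πm) = 0` ([6I] p. 23 *"u_k(0) = 1"*), the printed `∂^{(1)}_ρ(0)/∂_ρ(2πm) = 0` elsewhere. [cite: BalabanImbrieJaffe1985, (7.1.7) p.322] -/
theorem vC_zero_shift (hMn : 2 * M + 1 ≤ n) {m : Fin d → ℤ} (hm : m ∈ lShifts d M) (ρ : Fin d) :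
    vC n (shiftMom (0 : Fin d → ℝ) m) ρ = if m ρ = 0 then 1 else 0 := by
  have hn : 0 < n := by omega
  have hiff := dSym_shift_eq_zero_iff (n := n) hMn (abs_zero_le_pi ρ) hm (μ := ρ)
  by_cases hρ : m ρ = 0
  · rw [if_pos hρ]
    exact vC_eq_one hn (hiff.mpr ⟨rfl, hρ⟩)
  · rw [if_neg hρ]
    have hne : dSym ((n : ℝ)⁻¹) (shiftMom (0 : Fin d → ℝ) m) ρ ≠ 0 := fun h => hρ (hiff.mp h).2
    rw [vC_eq_vSym hn hne, vSym_eq, dOne_shiftMom]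
    simp [dOne]

/-- Hence `u^C(2πm) = δ_{m,0}` at `p′ = 0`. [cite: BalabanImbrieJaffe1985, (7.1.9) p.322] -/
theorem uC_zero_shift (hMn : 2 * M + 1 ≤ n) {m : Fin d → ℤ} (hm : m ∈ lShifts d M) :
    uC n (shiftMom (0 : Fin d → ℝ) m) = if m = 0 then 1 else 0 := by
  unfold uC
  simp only [vC_zero_shift hMn hm]
  by_cases h0 : m = 0
  · rw [if_pos h0]
    exact Finset.prod_eq_one fun ρ _ => by rw [if_pos (by rw [h0]; rfl)]
  · rw [if_neg h0]
    obtain ⟨ρ, hρ⟩ := Function.ne_iff.mp h0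
    exact Finset.prod_eq_zero (Finset.mem_univ ρ) (if_neg hρ)

/-- … and the bond weight `r_ν(2πm) = u·v_ν = δ_{m,0}` at `p′ = 0`: the constraint `Q_kA = 0` only sees the shift `l = 0`.
[cite: BalabanImbrieJaffe1985, (4.2.1) p.310] -/
theorem rC_zero_shift (hMn : 2 * M + 1 ≤ n) {m : Fin d → ℤ} (hm : m ∈ lShifts d M) (ν : Fin d) :
    rC n (0 : Fin d → ℝ) m ν = if m = 0 then 1 else 0 := by
  unfold rC
  rw [uC_zero_shift hMn hm, vC_zero_shift hMn hm ν]
  by_cases h0 : m = 0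
  · rw [if_pos h0, if_pos (by rw [h0]; rfl), one_mul]
  · rw [if_neg h0, zero_mul]

/-- **At `p′ = 0` the constraint `Q_kA = 0` reads `A(0) = 0`** (the η-bond field at the central shift vanishes).
[cite: BalabanImbrieJaffe1985, (4.2.1) p.310] -/
theorem qOpC_zero_iff (hMn : 2 * M + 1 ≤ n) (A : (Fin d → ℤ) → Fin d → ℂ) (ν : Fin d) :
    qOpC n M (0 : Fin d → ℝ) A ν = 0 ↔ A 0 ν = 0 := by
  have h : qOpC n M (0 : Fin d → ℝ) A ν = A 0 ν := by
    unfold qOpC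
    rw [Finset.sum_eq_single_of_mem (0 : Fin d → ℤ) (zero_mem_lShifts d M)]
    · rw [rC_zero_shift hMn (zero_mem_lShifts d M), if_pos rfl, one_mul]
    · intro m hm hm0
      rw [rC_zero_shift hMn hm, if_neg hm0, zero_mul]
  rw [h]

/-- **`σ^C(0) = τ₁^C(0)` as forms** (`τ₂^C(0) = 0`: (7.1.16) carries the factor `∂^{(1)}(0) = 0`, p10's `tau2C_zero`).
[cite: BalabanImbrieJaffe1985, (7.1.15) p.323] -/
theorem sigmaC_form_zero (n M : ℕ) (f : Fin d → Fin d → ℂ) :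
    tensorInner f (sigmaC (d := d) n M 0) f = tensorInner f (tau1C n M 0) f := by
  unfold sigmaC
  rw [tensorInner_add_kernel]
  have h0 : tensorInner f (tau2C (d := d) n M 0) f = 0 := by
    unfold tensorInner
    exact Finset.sum_eq_zero fun μ _ => Finset.sum_eq_zero fun ν _ => Finset.sum_eq_zero fun l _ =>
      Finset.sum_eq_zero fun κ _ => by rw [tau2C_zero]; ring
  rw [h0, add_zero]

/-- The Hodge field `B₀^C` of file 1 vanishes at the central shift when `p′ = 0` (`Δ(0) = 0`, and Lean's `0⁻¹ = 0` is exactly the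
right coefficient: the shift `l = 0` carries no curl), so it is constrained there. [cite: BalabanImbrieJaffe1985, (4.2.1) p.310] -/
theorem bZeroC_zero_central (n : ℕ) (f : Fin d → Fin d → ℂ) (ν : Fin d) : bZeroC n (0 : Fin d → ℝ) f 0 ν = 0 := by
  unfold bZeroC
  have h : lapSym ((n : ℝ)⁻¹) (shiftMom (0 : Fin d → ℝ) 0) = 0 := by
    rw [shiftMom_zero]
    unfold lapSym
    exact Finset.sum_eq_zero fun μ _ => by simp [dSym]
  rw [h, inv_zero, Complex.ofReal_zero, zero_mul]

/-- **At `p′ = 0` the constrained minimum is attained (at `B₀^C`) and equals `Re⟨f, σ^C(0)f⟩ = Re⟨f, τ₁^C(0)f⟩`** (`2M + 1 ≤ n`,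
two-forms `f`): lower bound from file 1 (every `A`), witness `B₀^C` (constrained by `qOpC_zero_iff`). [cite: BalabanImbrieJaffe1985, (7.1.13) p.322] -/
theorem isLeast_energyC_constrained_zero (hMn : 2 * M + 1 ≤ n) {f : Fin d → Fin d → ℂ} (hf : IsTwoForm f) :
    IsLeast {E | ∃ A : (Fin d → ℤ) → Fin d → ℂ, (∀ ν, qOpC n M (0 : Fin d → ℝ) A ν = 0) ∧ energyC n M 0 A f = E}
      (tensorInner f (sigmaC (d := d) n M 0) f).re := by
  have hn : 0 < n := by omega
  rw [sigmaC_form_zero]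
  refine ⟨⟨bZeroC n 0 f, fun ν => (qOpC_zero_iff hMn _ ν).mpr (bZeroC_zero_central n f ν), ?_⟩, ?_⟩
  · exact energyC_hodge_eq hn M 0 hf
  · rintro E ⟨A, -, rfl⟩
    exact tau1C_form_le_energyC hn M 0 hf A

end Zero

/-! ## §3 The constrained fibre minimum IS the regularized (7.1.13) form, at EVERY momentum of the closed cube -/

section Main

variable {p : Fin d → ℝ}

/-- **`min{‖∂A − Q^{e*}_kf‖²_C : Q_kA = 0} = Re⟨f, (τ₁^C + τ₂^C)(p′)f⟩` AT EVERY `p′` OF THE CLOSED CUBE `|p′_j| ≤ π`** (axis fibres and `p′ = 0`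
included; any `Scale` — `η = 1/n`, cut-off `M`, `2M + 1 ≤ n` —, `0 < d`, two-forms `f`): the fibre of (7.1.12) evaluated by (7.1.13)–(7.1.16)
in p10's regularized reading.  For `p′ ≠ 0`: file 2's minimiser + §1; for `p′ = 0`: §2. [cite: BalabanImbrieJaffe1985, (7.1.13) p.322] -/
theorem isLeast_energyC_constrained (hd : 0 < d) (s : Scale) (hp : ∀ i, |p i| ≤ Real.pi) {f : Fin d → Fin d → ℂ}
    (hf : IsTwoForm f) :
    IsLeast {E | ∃ A : (Fin d → ℤ) → Fin d → ℂ, (∀ ν, qOpC s.n s.M p A ν = 0) ∧ energyC s.n s.M p A f = E}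
      (tensorInner f (sigmaC s.n s.M p) f).re := by
  by_cases hp0 : p = 0
  · subst hp0
    exact isLeast_energyC_constrained_zero s.le hf
  · refine ⟨?_, ?_⟩
    · obtain ⟨A, hA, hE⟩ := exists_constrained_energyC_eq_form hd s hp hp0 hf
      exact ⟨A, hA, hE⟩
    · rintro E ⟨A, hA, rfl⟩
      exact sigmaC_form_le_energyC hd s hp hp0 hf hA

/-- … as an infimum: `inf{‖∂A − Q^{e*}_kf‖²_C : Q_kA = 0} = Re⟨f, σ^C_k(p′)f⟩` on the whole closed cube. [cite: BalabanImbrieJaffe1985, (7.1.12) p.322] -/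
theorem sInf_energyC_constrained (hd : 0 < d) (s : Scale) (hp : ∀ i, |p i| ≤ Real.pi) {f : Fin d → Fin d → ℂ}
    (hf : IsTwoForm f) :
    sInf {E | ∃ A : (Fin d → ℤ) → Fin d → ℂ, (∀ ν, qOpC s.n s.M p A ν = 0) ∧ energyC s.n s.M p A f = E}
      = (tensorInner f (sigmaC s.n s.M p) f).re :=
  (isLeast_energyC_constrained hd s hp hf).csInf_eq

end Main

/-! ## §4 The `Tor` level: `fibreMin (2M+1) N q φ = 2·Re⟨φ, σ^C(q)φ⟩` at EVERY dual momentum -/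

section TorLevel

variable (M : ℕ) {N : Fin d → ℕ} [∀ μ, NeZero (N μ)]

/-- **`m_{p′}(φ) = 2·Re⟨φ, σ^C(p′)φ⟩` AT EVERY DUAL MOMENTUM** (`n = 2M + 1`, two-forms `φ`, `0 < d`; the `2` = ordered-pair convention):
gen 6's `fibreMin_eq_two_mul_sigmaForm` WITHOUT the hypothesis *"all `p′_μ ≠ 0`"*, r15's printed `sigmaSym` being replaced by p10's
closed-cube `sigmaC` (equal to it off the axes, `sigmaC_form_eq`). [cite: BalabanImbrieJaffe1985, (7.1.13) p.322] -/
theorem fibreMin_eq_two_mul_sigmaC_form (hd : 0 < d) (q : Tor N) {φ : Fin d × Fin d → ℂ}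
    (hφ : ∀ μ ν, φ (ν, μ) = -φ (μ, ν)) :
    fibreMin (2 * M + 1) N q φ
      = 2 * (tensorInner (fun μ ν => φ (μ, ν)) (sigmaC (2 * M + 1) M (sOf N q)) (fun μ ν => φ (μ, ν))).re := by
  have hp : ∀ i, |sOf N q i| ≤ Real.pi := fun i => abs_sOf_le N q i
  have hf : IsTwoForm (fun μ ν => φ (μ, ν)) := fun μ ν => hφ μ ν
  have hL := isLeast_energyC_constrained hd ⟨2 * M + 1, M, le_rfl⟩ hp hf
  apply le_antisymm
  · obtain ⟨⟨A₀, hA₀, hE⟩, -⟩ := hL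
    set α : (Fin d → Fin (2 * M + 1)) → Fin d → ℂ := fun k => A₀ (resR M k) with hα
    have hcomp : (fun m => α (resE M m)) = fun m => A₀ (resR M (resE M m)) := rfl
    have hαc : FibreConstraint (2 * M + 1) N q α := by
      rw [fibreConstraint_iff M q α, hcomp]
      intro ν
      rw [qOpC_comp_res]
      exact hA₀ ν
    calc fibreMin (2 * M + 1) N q φ ≤ fibreEnergy (2 * M + 1) N q α φ := fibreMin_le _ _ hαc φ
      _ = 2 * energyC (2 * M + 1) M (sOf N q) (fun m => α (resE M m)) (fun μ ν => φ (μ, ν)) := fibreEnergy_eq M q α hφ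
      _ = _ := by rw [hcomp, energyC_comp_res, hE]
  · refine (le_fibreMin_iff _ _).2 fun α hα => ?_
    rw [fibreEnergy_eq M q α hφ]
    have hmem : energyC (2 * M + 1) M (sOf N q) (fun m => α (resE M m)) (fun μ ν => φ (μ, ν)) ∈
        {E | ∃ A : (Fin d → ℤ) → Fin d → ℂ, (∀ ν, qOpC (2 * M + 1) M (sOf N q) A ν = 0) ∧
          energyC (2 * M + 1) M (sOf N q) A (fun μ ν => φ (μ, ν)) = E} :=
      ⟨_, (fibreConstraint_iff M q α).1 hα, rfl⟩
    have h2 := hL.2 hmem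
    linarith

/-- **`m_{p′}(φ) − m°_{p′}(φ) = 2·Re⟨φ, τ₂^C(p′)φ⟩` at EVERY dual momentum**: constrained minus unconstrained fibre minimum is the
regularized (7.1.15)–(7.1.16) form (file 1 for `m°`). [cite: BalabanImbrieJaffe1985, (7.1.15) p.323] -/
theorem fibreMin_sub_fibreMinU_eq_two_mul_tau2C_form (hd : 0 < d) (q : Tor N) {φ : Fin d × Fin d → ℂ}
    (hφ : ∀ μ ν, φ (ν, μ) = -φ (μ, ν)) :
    fibreMin (2 * M + 1) N q φ - fibreMinU (2 * M + 1) N q φ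
      = 2 * (tensorInner (fun μ ν => φ (μ, ν)) (tau2C (2 * M + 1) M (sOf N q)) (fun μ ν => φ (μ, ν))).re := by
  rw [fibreMin_eq_two_mul_sigmaC_form M hd q hφ, fibreMinU_eq_two_mul_tau1C_form M q hφ]
  unfold sigmaC
  rw [tensorInner_add_kernel, Complex.add_re]
  ring

/-- **p. 324 *"In fact, 0 ≤ τ₂ is evident from (7.1.15)."* — here for the regularized symbol at EVERY dual momentum** (two-forms):
`0 ≤ Re⟨φ, τ₂^C(q)φ⟩`, since the constrained fibre minimum dominates the unconstrained one. [cite: BalabanImbrieJaffe1985, (7.1.25) p.324] -/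
theorem tau2C_form_nonneg (hd : 0 < d) (q : Tor N) {φ : Fin d × Fin d → ℂ} (hφ : ∀ μ ν, φ (ν, μ) = -φ (μ, ν)) :
    0 ≤ (tensorInner (fun μ ν => φ (μ, ν)) (tau2C (2 * M + 1) M (sOf N q)) (fun μ ν => φ (μ, ν))).re := by
  have h := fibreMin_sub_fibreMinU_eq_two_mul_tau2C_form M hd q hφ
  have h' := fibreMinU_le_fibreMin (2 * M + 1) N q φ
  linarith

end TorLevel

/-! ## §5 The σ_k and τ₂ of record at EVERY dual momentum -/

section Record

variable {P : Params} {k : ℕ}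

/-- **`σ_k(p′) = (τ₁ + τ₂)(p′)` FOR THE σ_k OF RECORD AT EVERY DUAL MOMENTUM, AXES INCLUDED** (p. 322 *"σ_k = τ₁ + τ₂ (7.1.13)"*): for the
torus σ_k of (4.2.1)–(4.2.2) (weight `η^d`, `η = L^{−k}`, any curl factor `c ≠ 0`; `k ≤ m + K`, `2 ≤ d`, `L^k = 2M + 1`) and every fibre
vector `ψ`: `⟨ψ, σ_k(p′)ψ⟩ = Re⟨ψ^asym, sigmaC (2M+1) M (p′) ψ^asym⟩` for EVERY `p′ : Tor (torN P k)` — p10's regularized (7.1.13)–(7.1.16)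
on the right, no hypothesis on the components of `p′` (gen 6's `symb_sigmaMatrix_form_eq_sigmaSym` is the generic case).
[cite: BalabanImbrieJaffe1985, (7.1.13) p.322] -/
theorem symb_sigmaMatrix_form_eq_sigmaC (hd : 2 ≤ P.d) (hk : k ≤ P.m + P.K) {c : ℝ} (hc : c ≠ 0) {M : ℕ}
    (hM : P.L ^ k = 2 * M + 1) (p : Tor (torN P k)) (ψ : Orient P → ℂ) :
    star ψ ⬝ᵥ (symb (torN P k) (Orient P) (sigmaMatrix hd (P.eta k ^ P.d) c k) p *ᵥ ψ)
      = (((tensorInner (fun μ ν => asymO ψ (μ, ν)) (sigmaC (2 * M + 1) M (sOf (Mk P k) p))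
          (fun μ ν => asymO ψ (μ, ν))).re : ℝ) : ℂ) := by
  haveI : NeZero (2 * M + 1) := ⟨by omega⟩
  rw [symb_sigmaMatrix_form_eq_half_fibreMin hd hk hc p ψ, fibreMin_congr_n hM,
    fibreMin_eq_two_mul_sigmaC_form M (by omega : 0 < P.d) p (asymO_swap ψ)]
  push_cast
  ring

/-- **`τ₂(p′)` OF THE τ₂ OF RECORD IS THE REGULARIZED (7.1.15)–(7.1.16) AT EVERY DUAL MOMENTUM**: for p33's `τ₂ = σ_k − τ₁` on the torus
(same standing hypotheses), `⟨ψ, τ₂(p′)ψ⟩ = Re⟨ψ^asym, tau2C (2M+1) M (p′) ψ^asym⟩` for EVERY `p′` (gen 6's `symb_tau2Matrix_form_eq_tau2Sym`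
is the generic case). [cite: BalabanImbrieJaffe1985, (7.1.15) p.323] -/
theorem symb_tau2Matrix_form_eq_tau2C (hd : 2 ≤ P.d) (hk : k ≤ P.m + P.K) {c : ℝ} (hc : c ≠ 0) {M : ℕ}
    (hM : P.L ^ k = 2 * M + 1) (p : Tor (torN P k)) (ψ : Orient P → ℂ) :
    star ψ ⬝ᵥ (symb (torN P k) (Orient P) (tau2Matrix hd (P.eta k ^ P.d) c k) p *ᵥ ψ)
      = (((tensorInner (fun μ ν => asymO ψ (μ, ν)) (tau2C (2 * M + 1) M (sOf (Mk P k) p))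
          (fun μ ν => asymO ψ (μ, ν))).re : ℝ) : ℂ) := by
  haveI : NeZero (2 * M + 1) := ⟨by omega⟩
  rw [symb_tau2Matrix_form_eq_half_sub hd hk hc p ψ, fibreMinU_congr_n hM, fibreMin_congr_n hM,
    fibreMin_sub_fibreMinU_eq_two_mul_tau2C_form M (by omega : 0 < P.d) p (asymO_swap ψ)]
  push_cast
  ring

/-- **At the zero dual momentum `τ₂(0) = 0` for the τ₂ of record**: `⟨ψ, τ₂(0)ψ⟩ = 0` for every `ψ` — the regularized (7.1.15) vanishes at
`p′ = 0` because `a(0) ∝ ∂^{(1)}(0) = 0` (p10's `tau2C_zero`). [cite: BalabanImbrieJaffe1985, (7.1.16) p.323] -/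
theorem symb_tau2Matrix_form_zero (hd : 2 ≤ P.d) (hk : k ≤ P.m + P.K) {c : ℝ} (hc : c ≠ 0) (ψ : Orient P → ℂ) :
    star ψ ⬝ᵥ (symb (torN P k) (Orient P) (tau2Matrix hd (P.eta k ^ P.d) c k) 0 *ᵥ ψ) = 0 := by
  obtain ⟨M, hM⟩ := BIJ85Eq7113SymbolIdentification.exists_pow_eq_two_mul_add_one P k
  rw [symb_tau2Matrix_form_eq_tau2C hd hk hc hM 0 ψ, sOf_zero]
  have h0 : tensorInner (fun μ ν => asymO ψ (μ, ν)) (tau2C (d := P.d) (2 * M + 1) M 0) (fun μ ν => asymO ψ (μ, ν)) = 0 := by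
    unfold tensorInner
    exact Finset.sum_eq_zero fun μ _ => Finset.sum_eq_zero fun ν _ => Finset.sum_eq_zero fun l _ =>
      Finset.sum_eq_zero fun κ _ => by rw [tau2C_zero]; ring
  rw [h0, Complex.zero_re, Complex.ofReal_zero]

end Record

end

end Literature.MathematicalPhysics.QuantumFieldTheory.BalabanImbrieJaffe1984to88.BIJ85Eq7113AxisFibres
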